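import Summits.QuantumFields.YangMills.Theorems.PoincareLipschitzWenteOneCentreIdentity
import Literature.Analysis.FluidPDE.PlanarPolarCoords
import Mathlib.MeasureTheory.Measure.Haar.NormedSpace
import Mathlib.MeasureTheory.Group.Integral
import Mathlib.MeasureTheory.Integral.Average
import HarnessLib

/-!
# Crux `BlockLipschitzL` (stmt-QuantumFields-23533) ∕ `HistoryTailL` (stmt-QuantumFields-19936), LINE 25, stub S1″ — ROAD (W)
# «the H-system gap at 3π», brick W-ONE «WENTE ONE-CENTRE LEMMA», file 4: THE ANNULAR KERNEL

Cell `ym3-torus` (YM ladder rung R3 = continuum SU(2) Yang–Mills on T³ — a RUNG, NOT Clay: not d = 4, not infinite volume,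
not a mass gap); TWIN-WIDTH helper seat `ym-ust-19936-w7` g15; `--supports stmt-QuantumFields-19936`; THEOREMS ONLY (0 `def`,
0 `sorry`, default heartbeats); imports file 2 (the annular profiles `h_r`, the kernel `Ψ(t) = (4∕3)·ST′((4t − 1)∕3)`,
`ST = Real.smoothTransition`), lit ✓`PlanarPolarCoords` (polar coordinates on `E²`), Mathlib.

WHAT THIS FILE PROVES (letters about the kernel of the smooth annular averages `𝒜_r u x = (π r²)⁻¹ ∫ Ψ(‖y − x‖²∕r²) u(y) dy`):
* ★ `exists_annularKernel_bound` — `|Ψ| ≤ M`;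
* ★★ `integral_annularKernel_norm_sq` — THE MASS `∫_{E²} Ψ(‖z‖²) dz = π` (polar coordinates: `2π ∫₀^∞ ρΨ(ρ²) dρ = π·(h₁(1) − h₁(0)) = π`);
* ★ `integral_annularKernel_rescaled` — `∫ Ψ(‖y − x‖²∕r²) dy = π r²`;
* ★★ `abs_annularAverage_sub_le_average` — `|𝒜_r u x − u x| ≤ C·⨍_{B̄_r(x)} |u − u x|` (`C = M·vol(B₁)∕π`), the letter for
  «`𝒜_r u x → u x` at every Lebesgue point»;
* ★ `continuousAt_annularAverage` — `x ↦ 𝒜_r u x` is continuous for locally integrable `u` (dominated convergence).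
HONEST SCOPE.  Kernel calculus; nothing of (W-OSC), (GAP), (TM), S1″, K1, `MeanDeviationL`, `BlockLipschitzL`, `HistoryTailL` is proved here.
YM₃ on T³ is rung R3, not Clay; YM gap NOT proved; no summit statement is proved here.

References: [Helein2002] §3.1; [Topping1997]; [BrezisCoron1985] Lemma A.1.
-/

set_option autoImplicit false

noncomputable section

open MeasureTheory Set Function Filter Topology Metric TopologicalSpace
open scoped ContDiff BigOperators RealInnerProductSpace

namespace Summit.QuantumFields.YangMills.Theorems.PoincareLipschitzWenteOneCentreKernel

open Literature.Analysis.FluidPDE (circlePt norm_circlePt integral_eq_integral_circlePt)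
open Summit.QuantumFields.YangMills.Theorems.PoincareLipschitzWenteOneCentreIdentity
  (annularKernel_props hasDerivAt_annularProfile annularProfile_eq_zero annularProfile_eq_one)

/-! ## §1 Boundedness and support of `Ψ` -/

/-- ★ The kernel `Ψ` is bounded: `∃ M ≥ 0, ∀ t, |Ψ t| ≤ M`. [folklore] -/
theorem exists_annularKernel_bound :
    ∃ M : ℝ, 0 ≤ M ∧ ∀ t : ℝ, |(4/3 : ℝ) * deriv Real.smoothTransition ((4 * t - 1) / 3)| ≤ M := by
  obtain ⟨hc, h0⟩ := annularKernel_props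
  obtain ⟨M, hM⟩ := (isCompact_Icc (a := (0:ℝ)) (b := 1)).exists_bound_of_continuousOn hc.continuousOn
  refine ⟨max M 0, le_max_right _ _, fun t => ?_⟩
  by_cases ht : t ∈ Icc (0:ℝ) 1
  · exact ((Real.norm_eq_abs _).symm.le.trans (hM t ht)).trans (le_max_left _ _)
  · rw [mem_Icc, not_and_or, not_le, not_le] at ht
    have : (4/3 : ℝ) * deriv Real.smoothTransition ((4 * t - 1) / 3) = 0 :=
      h0 t (ht.elim (fun h => Or.inl (by linarith)) fun h => Or.inr h.le)
    rw [this, abs_zero]; exact le_max_right _ _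

/-- The rescaled kernel `y ↦ Ψ(‖y − x‖²∕r²)` vanishes off the closed ball `B̄_r(x)`. [folklore] -/
theorem annularKernel_rescaled_eq_zero {x y : EuclideanSpace ℝ (Fin 2)} {r : ℝ} (hr : 0 < r) (hy : r < ‖y - x‖) :
    (4/3 : ℝ) * deriv Real.smoothTransition ((4 * (‖y - x‖ ^ 2 / r ^ 2) - 1) / 3) = 0 := by
  refine annularKernel_props.2 _ (Or.inr ?_)
  rw [le_div_iff₀ (by positivity), one_mul]
  exact pow_le_pow_left₀ hr.le hy.le 2

/-- The rescaled kernel is continuous in `y`. [folklore] -/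
theorem continuous_annularKernel_rescaled (x : EuclideanSpace ℝ (Fin 2)) (r : ℝ) :
    Continuous fun y : EuclideanSpace ℝ (Fin 2) => (4/3 : ℝ) * deriv Real.smoothTransition ((4 * (‖y - x‖ ^ 2 / r ^ 2) - 1) / 3) :=
  annularKernel_props.1.comp (((continuous_id.sub continuous_const).norm.pow 2).div_const _)

/-! ## §2 The mass of the kernel -/

/-- The radial profile `ρ ↦ 2πρΨ(ρ²)` integrates to `π` over `(0, ∞)`: `d∕dρ h₁(ρ²) = 2ρΨ(ρ²)`, `h₁(0) = 0`, `h₁(1) = 1`, and the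
profile vanishes for `ρ ≥ 1`. [folklore] -/
theorem integral_radialProfile_eq_pi :
    ∫ ρ in Ioi (0:ℝ), 2 * Real.pi * (ρ * ((4/3 : ℝ) * deriv Real.smoothTransition ((4 * ρ ^ 2 - 1) / 3))) = Real.pi := by
  obtain ⟨hΨc, hΨ0⟩ := annularKernel_props
  have hc : Continuous fun ρ : ℝ => 2 * Real.pi * (ρ * ((4/3 : ℝ) * deriv Real.smoothTransition ((4 * ρ ^ 2 - 1) / 3))) :=
    continuous_const.mul (continuous_id.mul (hΨc.comp (continuous_id.pow 2)))
  have hprim : ∀ ρ : ℝ, HasDerivAt (fun ρ : ℝ => Real.pi * Real.smoothTransition ((4 * ρ ^ 2 / 1 ^ 2 - 1) / 3))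
      (2 * Real.pi * (ρ * ((4/3 : ℝ) * deriv Real.smoothTransition ((4 * ρ ^ 2 - 1) / 3)))) ρ := by
    intro ρ
    have h1 : HasDerivAt (fun s : ℝ => Real.smoothTransition ((4 * s / 1 ^ 2 - 1) / 3))
        ((1 ^ 2)⁻¹ * ((4/3 : ℝ) * deriv Real.smoothTransition ((4 * ((fun x : ℝ => x ^ 2) ρ / 1 ^ 2) - 1) / 3)))
        ((fun x : ℝ => x ^ 2) ρ) := hasDerivAt_annularProfile one_pos _
    have h2 : HasDerivAt (fun x : ℝ => x ^ 2) (↑(2:ℕ) * ρ ^ (2 - 1)) ρ := hasDerivAt_pow 2 ρ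
    have h := (HasDerivAt.comp (h := fun x : ℝ => x ^ 2) ρ h1 h2).const_mul Real.pi
    refine h.congr_deriv ?_
    simp only [one_pow, div_one, inv_one, one_mul, Nat.cast_ofNat]
    ring
  have hzero : ∀ ρ : ℝ, 1 ≤ ρ → 2 * Real.pi * (ρ * ((4/3 : ℝ) * deriv Real.smoothTransition ((4 * ρ ^ 2 - 1) / 3))) = 0 := by
    intro ρ hρ
    rw [hΨ0 _ (Or.inr (by nlinarith)), mul_zero, mul_zero]
  have htail : ∫ ρ in Ioi (1:ℝ), 2 * Real.pi * (ρ * ((4/3 : ℝ) * deriv Real.smoothTransition ((4 * ρ ^ 2 - 1) / 3))) = 0 :=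
    setIntegral_eq_zero_of_forall_eq_zero (t := Ioi (1:ℝ)) fun ρ hρ => hzero ρ (le_of_lt hρ)
  have hsplit : ∫ ρ in Ioi (0:ℝ), 2 * Real.pi * (ρ * ((4/3 : ℝ) * deriv Real.smoothTransition ((4 * ρ ^ 2 - 1) / 3))) =
      ∫ ρ in (0:ℝ)..1, 2 * Real.pi * (ρ * ((4/3 : ℝ) * deriv Real.smoothTransition ((4 * ρ ^ 2 - 1) / 3))) := by
    rw [intervalIntegral.integral_of_le zero_le_one, ← Ioc_union_Ioi_eq_Ioi zero_le_one,
      setIntegral_union (Set.Ioc_disjoint_Ioi le_rfl) measurableSet_Ioi, htail, add_zero]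
    · exact (hc.integrableOn_Icc).mono_set Ioc_subset_Icc_self
    · exact (integrableOn_congr_fun (fun ρ hρ => hzero ρ (le_of_lt hρ)) measurableSet_Ioi).2 integrableOn_zero
  rw [hsplit, intervalIntegral.integral_eq_sub_of_hasDerivAt (fun ρ _ => hprim ρ) (hc.intervalIntegrable _ _)]
  simp only [one_pow, div_one]
  rw [Real.smoothTransition.one_of_one_le (by norm_num), Real.smoothTransition.zero_of_nonpos (by norm_num)]
  ring

/-- ★★ **THE MASS OF THE KERNEL**: `∫_{E²} Ψ(‖z‖²) dz = π` — polar coordinates (lit `integral_eq_integral_circlePt`) and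
`integral_radialProfile_eq_pi`. [folklore] -/
theorem integral_annularKernel_norm_sq :
    ∫ z : EuclideanSpace ℝ (Fin 2), (4/3 : ℝ) * deriv Real.smoothTransition ((4 * ‖z‖ ^ 2 - 1) / 3) = Real.pi := by
  obtain ⟨hΨc, hΨ0⟩ := annularKernel_props
  have hK : Continuous fun z : EuclideanSpace ℝ (Fin 2) => (4/3 : ℝ) * deriv Real.smoothTransition ((4 * ‖z‖ ^ 2 - 1) / 3) :=
    hΨc.comp (continuous_norm.pow 2)
  have hKs : HasCompactSupport fun z : EuclideanSpace ℝ (Fin 2) => (4/3 : ℝ) * deriv Real.smoothTransition ((4 * ‖z‖ ^ 2 - 1) / 3) := by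
    apply HasCompactSupport.intro (isCompact_closedBall (0 : EuclideanSpace ℝ (Fin 2)) 1)
    intro z hz
    rw [mem_closedBall, dist_zero_right, not_le] at hz
    exact hΨ0 _ (Or.inr (by nlinarith))
  have hint : Integrable (fun z : EuclideanSpace ℝ (Fin 2) => (4/3 : ℝ) * deriv Real.smoothTransition ((4 * ‖z‖ ^ 2 - 1) / 3)) :=
    hK.integrable_of_hasCompactSupport hKs
  have hθ : ∀ ρ : ℝ, ∫ θ in Ioc (-Real.pi) Real.pi, ρ • ((4/3 : ℝ) * deriv Real.smoothTransition ((4 * ‖circlePt ρ θ‖ ^ 2 - 1) / 3)) =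
      2 * Real.pi * (ρ * ((4/3 : ℝ) * deriv Real.smoothTransition ((4 * ρ ^ 2 - 1) / 3))) := by
    intro ρ
    have hcst : (fun θ : ℝ => ρ • ((4/3 : ℝ) * deriv Real.smoothTransition ((4 * ‖circlePt ρ θ‖ ^ 2 - 1) / 3))) =
        fun _ => ρ * ((4/3 : ℝ) * deriv Real.smoothTransition ((4 * ρ ^ 2 - 1) / 3)) := by
      funext θ
      rw [norm_circlePt, sq_abs, smul_eq_mul]
    rw [hcst, setIntegral_const, smul_eq_mul, Real.volume_real_Ioc, max_eq_left (by linarith [Real.pi_pos])]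
    ring
  rw [integral_eq_integral_circlePt hint]
  simp_rw [hθ]
  exact integral_radialProfile_eq_pi

/-- ★ The rescaled mass: `∫ Ψ(‖y − x‖²∕r²) dy = π r²`. [folklore] -/
theorem integral_annularKernel_rescaled (x : EuclideanSpace ℝ (Fin 2)) {r : ℝ} (hr : 0 < r) :
    ∫ y : EuclideanSpace ℝ (Fin 2), (4/3 : ℝ) * deriv Real.smoothTransition ((4 * (‖y - x‖ ^ 2 / r ^ 2) - 1) / 3) = Real.pi * r ^ 2 := by
  have h1 : (fun y : EuclideanSpace ℝ (Fin 2) => (4/3 : ℝ) * deriv Real.smoothTransition ((4 * (‖y - x‖ ^ 2 / r ^ 2) - 1) / 3)) =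
      fun y => (fun z : EuclideanSpace ℝ (Fin 2) => (4/3 : ℝ) * deriv Real.smoothTransition ((4 * ‖r⁻¹ • z‖ ^ 2 - 1) / 3)) (y - x) := by
    funext y
    simp only
    rw [norm_smul, Real.norm_eq_abs, abs_inv, abs_of_pos hr, mul_pow, inv_pow, ← div_eq_inv_mul]
  rw [h1, integral_sub_right_eq_self (μ := volume)
    (fun z : EuclideanSpace ℝ (Fin 2) => (4/3 : ℝ) * deriv Real.smoothTransition ((4 * ‖r⁻¹ • z‖ ^ 2 - 1) / 3)) x]
  rw [Measure.integral_comp_inv_smul_of_nonneg volume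
    (fun z : EuclideanSpace ℝ (Fin 2) => (4/3 : ℝ) * deriv Real.smoothTransition ((4 * ‖z‖ ^ 2 - 1) / 3)) hr.le]
  rw [integral_annularKernel_norm_sq, finrank_euclideanSpace_fin, smul_eq_mul, mul_comm]

/-! ## §3 The smooth annular average against the value at the centre, and continuity in the centre -/

/-- ★★ **`𝒜_r u x − u x` against the mean oscillation**: for locally integrable `u` and `r > 0`,
`|(π r²)⁻¹ ∫ Ψ(‖y − x‖²∕r²) u(y) dy − u x| ≤ (M · vol(B₁) ∕ π) · ⨍_{B̄_r(x)} |u y − u x| dy`, `M` the bound of `Ψ` — so that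
`𝒜_r u x → u x` at every Lebesgue point of `u`. [folklore] -/
theorem abs_annularAverage_sub_le_average {u : EuclideanSpace ℝ (Fin 2) → ℝ} (hu : LocallyIntegrable u volume)
    {M : ℝ} (hM : ∀ t : ℝ, |(4/3 : ℝ) * deriv Real.smoothTransition ((4 * t - 1) / 3)| ≤ M)
    (x : EuclideanSpace ℝ (Fin 2)) {r : ℝ} (hr : 0 < r) :
    |(Real.pi * r ^ 2)⁻¹ * (∫ y, (4/3 : ℝ) * deriv Real.smoothTransition ((4 * (‖y - x‖ ^ 2 / r ^ 2) - 1) / 3) * u y) - u x| ≤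
      (M * volume.real (ball (0 : EuclideanSpace ℝ (Fin 2)) 1) / Real.pi) * ⨍ y in closedBall x r, |u y - u x| := by
  have hπ : 0 < Real.pi := Real.pi_pos
  set k : EuclideanSpace ℝ (Fin 2) → ℝ := fun y => (4/3 : ℝ) * deriv Real.smoothTransition ((4 * (‖y - x‖ ^ 2 / r ^ 2) - 1) / 3) with hk
  have hkc : Continuous k := continuous_annularKernel_rescaled x r
  have hks : HasCompactSupport k := by
    apply HasCompactSupport.intro (isCompact_closedBall x r)
    intro y hy
    rw [mem_closedBall, dist_eq_norm, not_le] at hy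
    exact annularKernel_rescaled_eq_zero hr hy
  have hku : Integrable (fun y => k y * u y) := by
    simpa [smul_eq_mul] using hu.integrable_smul_left_of_hasCompactSupport hkc hks
  have hk1 : Integrable k := hkc.integrable_of_hasCompactSupport hks
  -- `𝒜_r u x − u x = (π r²)⁻¹ ∫ k·(u − u x)`
  have hmass : ∫ y, k y = Real.pi * r ^ 2 := integral_annularKernel_rescaled x hr
  have hdiff : (Real.pi * r ^ 2)⁻¹ * (∫ y, k y * u y) - u x = (Real.pi * r ^ 2)⁻¹ * ∫ y, k y * (u y - u x) := by
    have : ∫ y, k y * (u y - u x) = (∫ y, k y * u y) - (∫ y, k y) * u x := by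
      rw [← integral_mul_const, ← integral_sub hku (hk1.mul_const _)]
      exact integral_congr_ae (Filter.Eventually.of_forall fun y => by ring)
    rw [this, hmass]
    field_simp
  rw [hdiff]
  -- bound the integral by `M ∫_{B̄_r(x)} |u − u x|`
  have hsupp : ∀ y, y ∉ closedBall x r → k y * (u y - u x) = 0 := by
    intro y hy
    rw [mem_closedBall, dist_eq_norm, not_le] at hy
    rw [show k y = 0 from annularKernel_rescaled_eq_zero hr hy, zero_mul]
  have hloc : IntegrableOn (fun y => |u y - u x|) (closedBall x r) volume :=
    ((hu.integrableOn_isCompact (isCompact_closedBall x r)).sub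
      (integrableOn_const (hs := (isCompact_closedBall x r).measure_lt_top.ne))).abs
  have hbd : |∫ y, k y * (u y - u x)| ≤ M * ∫ y in closedBall x r, |u y - u x| := by
    rw [← setIntegral_eq_integral_of_forall_compl_eq_zero hsupp, ← integral_const_mul]
    refine (abs_integral_le_integral_abs).trans (setIntegral_mono_on ?_ (hloc.const_mul M) measurableSet_closedBall
      fun y _ => ?_)
    · exact ((hku.sub (hk1.mul_const (u x))).congr (Filter.Eventually.of_forall fun y => by simp only [Pi.sub_apply]; ring)).abs.integrableOn
    · rw [abs_mul]
      exact mul_le_mul_of_nonneg_right (hM _) (abs_nonneg _)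
  -- the volume of the closed ball
  have hvol : volume.real (closedBall x r) = r ^ 2 * volume.real (ball (0 : EuclideanSpace ℝ (Fin 2)) 1) := by
    rw [Measure.addHaar_real_closedBall volume x hr.le, finrank_euclideanSpace_fin]
  have hvpos : 0 < volume.real (ball (0 : EuclideanSpace ℝ (Fin 2)) 1) :=
    ENNReal.toReal_pos (measure_ball_pos volume _ one_pos).ne' measure_ball_lt_top.ne
  have havg : ∫ y in closedBall x r, |u y - u x| = volume.real (closedBall x r) * ⨍ y in closedBall x r, |u y - u x| := by
    rw [setAverage_eq, smul_eq_mul, ← mul_assoc, mul_inv_cancel₀, one_mul]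
    rw [hvol]; positivity
  rw [abs_mul, abs_inv, abs_of_pos (by positivity : 0 < Real.pi * r ^ 2)]
  calc (Real.pi * r ^ 2)⁻¹ * |∫ y, k y * (u y - u x)|
      ≤ (Real.pi * r ^ 2)⁻¹ * (M * ∫ y in closedBall x r, |u y - u x|) :=
        mul_le_mul_of_nonneg_left hbd (by positivity)
    _ = (M * volume.real (ball (0 : EuclideanSpace ℝ (Fin 2)) 1) / Real.pi) * ⨍ y in closedBall x r, |u y - u x| := by
        rw [havg, hvol]
        field_simp

/-- ★ **Continuity of the smooth annular average in the centre** for locally integrable `u` (dominated convergence; the kernel is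
continuous and the supports near `x₀` stay in one compact ball). [folklore] -/
theorem continuousAt_annularAverage {u : EuclideanSpace ℝ (Fin 2) → ℝ} (hu : LocallyIntegrable u volume)
    {r : ℝ} (hr : 0 < r) (x₀ : EuclideanSpace ℝ (Fin 2)) :
    ContinuousAt (fun x : EuclideanSpace ℝ (Fin 2) =>
      ∫ y, (4/3 : ℝ) * deriv Real.smoothTransition ((4 * (‖y - x‖ ^ 2 / r ^ 2) - 1) / 3) * u y) x₀ := by
  obtain ⟨M, hM0, hM⟩ := exists_annularKernel_bound
  obtain ⟨hΨc, -⟩ := annularKernel_props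
  have hul : ∀ x, Integrable (fun y => (4/3 : ℝ) * deriv Real.smoothTransition ((4 * (‖y - x‖ ^ 2 / r ^ 2) - 1) / 3) * u y) := by
    intro x
    have hks : HasCompactSupport fun y : EuclideanSpace ℝ (Fin 2) =>
        (4/3 : ℝ) * deriv Real.smoothTransition ((4 * (‖y - x‖ ^ 2 / r ^ 2) - 1) / 3) := by
      apply HasCompactSupport.intro (isCompact_closedBall x r)
      intro y hy
      rw [mem_closedBall, dist_eq_norm, not_le] at hy
      exact annularKernel_rescaled_eq_zero hr hy
    simpa [smul_eq_mul] using hu.integrable_smul_left_of_hasCompactSupport (continuous_annularKernel_rescaled x r) hks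
  refine continuousAt_of_dominated (bound := fun y => M * ((closedBall x₀ (r + 1)).indicator (fun y => |u y|) y)) ?_ ?_ ?_ ?_
  · exact Filter.Eventually.of_forall fun x => (hul x).aestronglyMeasurable
  · filter_upwards [Metric.ball_mem_nhds x₀ one_pos] with x hx
    refine Filter.Eventually.of_forall fun y => ?_
    rw [Real.norm_eq_abs, abs_mul]
    by_cases hy : y ∈ closedBall x₀ (r + 1)
    · rw [indicator_of_mem hy]
      exact mul_le_mul_of_nonneg_right (hM _) (abs_nonneg _)
    · have hfar : r < ‖y - x‖ := by
        rw [mem_closedBall, not_le, dist_eq_norm] at hy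
        rw [mem_ball, dist_eq_norm] at hx
        have := norm_sub_le_norm_sub_add_norm_sub y x x₀
        linarith
      rw [annularKernel_rescaled_eq_zero hr hfar, abs_zero, zero_mul]
      exact mul_nonneg hM0 (indicator_nonneg (fun _ _ => abs_nonneg _) _)
  · exact (IntegrableOn.integrable_indicator (hu.integrableOn_isCompact (isCompact_closedBall x₀ (r + 1))).abs
      measurableSet_closedBall).const_mul M
  · refine Filter.Eventually.of_forall fun y => ?_
    exact ((hΨc.comp ((((continuous_const.sub continuous_id).norm.pow 2).div_const _))).mul continuous_const).continuousAt

end Summit.QuantumFields.YangMills.Theorems.PoincareLipschitzWenteOneCentreKernel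

end
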